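import Literature.AlgebraicTopology.Homotopy.SphereConnectedCover
import Literature.Topology.FourManifolds.ComplexProjectiveSpaceComparison
import Literature.Topology.FourManifolds.ComplexProjectiveSpaceCohomologyRing
import HarnessLib

/-!
# The fibre of `S³⟨3⟩ → S³` is a `K(ℤ, 2)` with polynomial integral cohomology

Topic `Literature/AlgebraicTopology/Homotopy`. A. Hatcher, *Algebraic Topology* (2002), §4.3,
Example 4.72 (the fibre of the first Whitehead stage `S³⟨3⟩ → S³` is `ΩP₃S³`, a `K(ℤ, 2)`), with
Example 4.50 / Thm. 4.58 (a `K(ℤ, 2)` receives a `(2N+1)`-connected map from `ℂPᴺ`, so its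
cohomology ring is that of `ℂP^∞`: "`H*(K(ℤ,2); ℤ) ≅ ℤ[x]`, `|x| = 2`", p. 393 and Thm. 3.12).
For the tree's cover `SphereCover.E 3 v → 𝕊³` (`SphereConnectedCover.lean`) and its fibre
`F = SphereCover.Fib 3 v` we PROVE (no definitions, no named facts):

* `SphereCover.exists_comparison_fib_three` — for every `kk`, a map `c : ℂP¹⁺ᵏᵏ → F` with
  `c^* : Hⁱ(F; M) ≅ Hⁱ(ℂP¹⁺ᵏᵏ; M)` for all `i ≤ 2(1 + kk)` (any principal ideal domain `R`,
  `R`-module `M`) and `c_*` an isomorphism on `Hᵢ(-; R)` in the same range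
  (`ComplexProjectiveSpace.exists_comparison_isIso_singularCohomology` fed with `π₂(F) ≅ ℤ`,
  `πⱼ(F) = 0` for `j ≥ 3`, `F` path connected and simply connected);
* `SphereCover.isZero_singularCohomology_fib_three_of_odd` — `Hⁱ(F; ℤ) = 0` for `i` odd;
* `SphereCover.nonempty_singularCohomology_fib_three_equiv_int` — `H²ʲ⁺²(F; ℤ) ≅ ℤ`;
* `SphereCover.exists_generator_fib_three` — **there is `x ∈ H²(F; ℤ)` whose cup powers `xʲ`
  (`cupPowL x j`) generate `H²ʲ(F; ℤ)` for every `j`** (transport of the tree's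
  `ComplexProjectiveSpace.span_cupPowL_eq_top` along the multiplicative isomorphisms `c^*`).

This is the coefficient input `H*(K(ℤ, 2); ℤ) = ℤ[x]` of the Wang sequence of `S³⟨3⟩ → S³`
(Serre's computation of `H*(S³⟨3⟩)`), drawn downstream.

## References

* A. Hatcher, *Algebraic Topology*, CUP (2002), §4.3 Example 4.72; §4.2 Example 4.50; Thm. 4.58;
  p. 393; Thm. 3.12. [HatcherAT2002]
-/

noncomputable section

open Set Metric Function Topology CategoryTheory CategoryTheory.Limits
open scoped unitInterval Topology

namespace Literature.AlgebraicTopology.Homotopy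

open Literature.AlgebraicTopology.SingularHomology Literature.Topology.FourManifolds

namespace SphereCover

variable (v : Metric.sphere (0 : EuclideanSpace ℝ (Fin (3 + 1))) 1)

/-- The fibre of `S³⟨3⟩ → S³` is path connected. [cite: HatcherAT2002, §4.3 Example 4.72] -/
instance pathConnectedSpace_fib_three : PathConnectedSpace (Fib 3 v) :=
  pathConnectedSpace_fib 3 v (by norm_num)

/-- The fibre of `S³⟨3⟩ → S³` is simply connected. [cite: HatcherAT2002, §4.3 Example 4.72] -/
instance simplyConnectedSpace_fib_three : SimplyConnectedSpace (Fib 3 v) :=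
  simplyConnectedSpace_fib 3 v le_rfl

universe w

/-- **The comparison `ℂP¹⁺ᵏᵏ → F`** for the `K(ℤ, 2)`-fibre of `S³⟨3⟩ → S³`: isomorphisms
`c^* : Hⁱ(F; M) ≅ Hⁱ(ℂP¹⁺ᵏᵏ; M)` and `c_*` on `Hᵢ(-; R)` for `i ≤ 2(1+kk)`.
[cite: HatcherAT2002, Example 4.50, Thm. 4.58, §4.3 Example 4.72] -/
theorem exists_comparison_fib_three (kk : ℕ) :
    ∃ (c : C(ComplexProjectiveSpace (1 + kk), Fib 3 v)) (x₁ : ComplexProjectiveSpace (1 + kk)),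
      c x₁ = fib₀ 3 v ∧
      (∀ (R : Type w) [CommRing R] [IsDomain R] [IsPrincipalIdealRing R]
        (M : Type w) [AddCommGroup M] [Module R M] (i : ℕ), i ≤ 2 * (1 + kk) →
        IsIso (singularCohomology.map R M c i)) ∧
      (∀ (R : Type w) [CommRing R] (i : ℕ), i ≤ 2 * (1 + kk) →
        IsIso (singularHomology.map R R c i)) := by
  obtain ⟨ψ⟩ := nonempty_mulEquiv_homotopyGroup_fib_int 1 v
  exact ComplexProjectiveSpace.exists_comparison_isIso_singularCohomology (K := Fib 3 v) (fib₀ 3 v) ψ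
    (fun j hj x => subsingleton_homotopyGroup_fib 3 v (by omega) (by omega) x) kk

/-- **`Hⁱ(F; ℤ) = 0` for `i` odd** (`F` the `K(ℤ,2)`-fibre of `S³⟨3⟩ → S³`).
[cite: HatcherAT2002, Thm. 3.12, Example 4.50] -/
theorem isZero_singularCohomology_fib_three_of_odd {i : ℕ} (hi : ¬ Even i) :
    IsZero (singularCohomology ℤ ℤ (Fib 3 v) i) := by
  obtain ⟨c, -, -, hc, -⟩ := exists_comparison_fib_three.{0} v i
  haveI := hc ℤ ℤ i (by omega)
  exact (ComplexProjectiveSpace.isZero_singularCohomology_int (n := 1 + i) (fun h => hi h.1)).of_iso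
    (asIso (singularCohomology.map ℤ ℤ c i))

/-- **`H²ʲ⁺²(F; ℤ) ≅ ℤ`** (`F` the `K(ℤ,2)`-fibre of `S³⟨3⟩ → S³`).
[cite: HatcherAT2002, Thm. 3.12, Example 4.50] -/
theorem nonempty_singularCohomology_fib_three_equiv_int (j : ℕ) :
    Nonempty (singularCohomology ℤ ℤ (Fib 3 v) (2 * j + 2) ≃ₗ[ℤ] ℤ) := by
  obtain ⟨c, -, -, hc, -⟩ := exists_comparison_fib_three.{0} v j
  haveI := hc ℤ ℤ (2 * j + 2) (by omega)
  obtain ⟨e⟩ := ComplexProjectiveSpace.nonempty_singularCohomology_equiv_int (n := 1 + j) (k := 2 * j + 1)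
    ⟨⟨j + 1, by ring⟩, by omega⟩
  exact ⟨(asIso (singularCohomology.map ℤ ℤ c (2 * j + 2))).toLinearEquiv.trans e⟩

/-- **`H*(F; ℤ) = ℤ[x]`**: there is `x ∈ H²(F; ℤ)` such that `xʲ = cupPowL x j` generates
`H²ʲ(F; ℤ)` for every `j` (`F` the `K(ℤ,2)`-fibre of `S³⟨3⟩ → S³`; transport of the ring structure
of `H*(ℂP¹⁺ʲ; ℤ)` along the multiplicative isomorphisms `c^*`).
[cite: HatcherAT2002, Thm. 3.12, Example 4.50, p. 393] -/
theorem exists_generator_fib_three :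
    ∃ x : singularCohomology ℤ ℤ (Fib 3 v) 2, Submodule.span ℤ {x} = ⊤ ∧
      ∀ j : ℕ, Submodule.span ℤ {cupPowL x j} = ⊤ := by
  -- a generator of `H²(F; ℤ) ≅ ℤ`
  obtain ⟨e⟩ := nonempty_singularCohomology_fib_three_equiv_int v 0
  let x : singularCohomology ℤ ℤ (Fib 3 v) 2 := e.symm 1
  have hx : Submodule.span ℤ {x} = ⊤ :=
    (span_singleton_eq_top_iff_of_equiv e x).2 (Or.inl (e.apply_symm_apply 1))
  refine ⟨x, hx, fun j => ?_⟩
  -- compare with `ℂP¹⁺ʲ`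
  obtain ⟨c, -, -, hc, -⟩ := exists_comparison_fib_three.{0} v j
  haveI h2 := hc ℤ ℤ 2 (by omega)
  haveI h2j := hc ℤ ℤ (2 * j) (by omega)
  let e2 := (asIso (singularCohomology.map ℤ ℤ c 2)).toLinearEquiv
  let e2j := (asIso (singularCohomology.map ℤ ℤ c (2 * j))).toLinearEquiv
  -- `c^* x` generates `H²(ℂP¹⁺ʲ; ℤ)`, hence `(c^* x)ʲ = c^* (xʲ)` generates `H²ʲ(ℂP¹⁺ʲ; ℤ)`
  have hx' : Submodule.span ℤ {singularCohomology.map ℤ ℤ c 2 x} = ⊤ :=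
    span_singleton_eq_top_of_equiv e2 hx
  have hpow := ComplexProjectiveSpace.span_cupPowL_eq_top (1 + j) _ hx' (k := j) (by omega)
  rw [← map_cupPowL] at hpow
  have h := span_singleton_eq_top_of_equiv e2j.symm hpow
  have hid : e2j.symm (singularCohomology.map ℤ ℤ c (2 * j) (cupPowL x j)) = cupPowL x j :=
    e2j.symm_apply_apply (cupPowL x j)
  rwa [hid] at h

end SphereCover

end Literature.AlgebraicTopology.Homotopy

end
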